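import Literature.Analysis.FunctionSpaces.BesovFatou
import Literature.Analysis.FunctionSpaces.LittlewoodPaleyProofs
import HarnessLib

/-!
# Off-diagonal decay of Schwartz-symbol multipliers and of the low-frequency cut-offs `Ṡ_N`

Analysis/FunctionSpaces proof file (theorems only: no definition, no named fact). The kernel
estimate behind the *local* form of the interpolation inequality of W. Wang, Z. Zhang, Sci. China
Math. 60 (2017) = arXiv:1510.02589, Lemma 3.2 (used in §4 Step 1 there on balls `B₁(x₀)`,
`|x₀| → ∞`): the value at `a` of `Ψ(D)T`, for a tempered distribution `T` given by a locally
integrable function `f` **vanishing on the ball `B(a, r)`**, only sees `f` through the tail of the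
kernel `𝓕Ψ` beyond distance `r`:

* `enorm_apply_compSubConstCLM_le_of_eqOn_ball` — for every Schwartz `Φ` and `m ∈ ℕ`,
  `‖⟨T, Φ(· - a)⟩‖ ≤ p_{m,0}(Φ) ∫_{|y-a| ≥ r} |y - a|^{-m} ‖f(y)‖ dy` (in `[0, ∞]`), where
  `p_{m,0}(Φ) = sup_z ‖z‖^m ‖Φ(z)‖` is the Schwartz seminorm; with `Φ = 𝓕Ψ` the left-hand side is
  the pointwise value of `Ψ(D)T` at `a` (`fourierMultiplierCLM_schwartz_apply_eq_integral`,
  `lowFreqCutoff_apply_eq_integral_of_coe_eq`);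
* `seminorm_fourier_le_of_coe_eq_lowFreqSymbol` — **scaling of the kernels of `Ṡ_N`**: for Schwartz
  representatives `Ψ_N`, `Ψ₀` of the symbols `χ(2^{-N}·)`, `χ(·)`,
  `p_{m,0}(𝓕Ψ_N) ≤ 2^{N(d-m)} p_{m,0}(𝓕Ψ₀)`, `d = dim E` (`𝓕Ψ_N = 2^{Nd} (𝓕Ψ₀)(2^N ·)`,
  `fourier_apply_of_coe_eq_lowFreqSymbol`);
* `enorm_lowFreqCutoff_value_le_of_eqOn_ball` — the two combined: the values of `Ṡ_N T` on the
  region where `f` vanishes to distance `r` are bounded by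
  `2^{N(d-m)} p_{m,0}(𝓕Ψ₀) ∫_{|y-a| ≥ r} |y-a|^{-m} ‖f(y)‖ dy` — small for `N → +∞` once `m > d`
  (uniformly locally integrable `f`: the integral is finite for `m > d`).

## References

* W. Wang, Z. Zhang, Sci. China Math. 60 (2017) 637–650 = arXiv:1510.02589, Lemma 3.2 and §4
  Step 1. [WangZhang2016]
* H. Bahouri, J.-Y. Chemin, R. Danchin, *Fourier Analysis and Nonlinear PDE* (2011), §2.1
  (kernels of `Ṡ_j`: `2^{jd} h(2^j ·)`, `h = 𝓕⁻¹χ ∈ 𝓢`). [BahouriCheminDanchin2011]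
-/

noncomputable section

open MeasureTheory TemperedDistribution Filter Set Function
open _root_.Topology _root_.FourierTransform
open scoped SchwartzMap ENNReal NNReal

namespace Literature.Analysis.FunctionSpaces

variable {E : Type*} [NormedAddCommGroup E] [InnerProductSpace ℝ E] [FiniteDimensional ℝ E]
  [MeasurableSpace E] [BorelSpace E] {F : Type*} [NormedAddCommGroup F] [NormedSpace ℂ F]

/-! ## Pairing with a translated test function only sees the tail of the representing function -/

omit [FiniteDimensional ℝ E] [MeasurableSpace E] [BorelSpace E] in
/-- Pointwise decay of a Schwartz function from its seminorm: `‖Φ(z)‖ ≤ p_{m,0}(Φ) / ‖z‖^m` for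
`z ≠ 0`. [folklore] -/
theorem norm_apply_le_seminorm_mul_inv_pow (Φ : 𝓢(E, ℂ)) (m : ℕ) {z : E} (hz : z ≠ 0) :
    ‖Φ z‖ ≤ SchwartzMap.seminorm ℂ m 0 Φ * (‖z‖ ^ m)⁻¹ := by
  have h := SchwartzMap.le_seminorm ℂ m 0 Φ z
  rw [norm_iteratedFDeriv_zero] at h
  have hpos : 0 < ‖z‖ ^ m := pow_pos (norm_pos_iff.2 hz) m
  rw [← div_eq_mul_inv, le_div_iff₀ hpos, mul_comm]
  exact h

/-- **Off-diagonal bound for pairings with translated test functions.** Let the tempered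
distribution `T` be given by integration against `f` (`⟨T, θ⟩ = ∫ θ • f` for all Schwartz `θ`)
and let `f` vanish on the ball `B(a, r)`, `r > 0`. Then for every Schwartz `Φ` and `m ∈ ℕ`,
`‖⟨T, Φ(· - a)⟩‖ ≤ p_{m,0}(Φ) · ∫_{|y - a| ≥ r} |y - a|^{-m} ‖f y‖ dy` in `[0, ∞]`. With
`Φ = 𝓕Ψ` the left-hand side is the value at `a` of `Ψ(D)T`
(`fourierMultiplierCLM_schwartz_apply_eq_integral`). [cite: WangZhang2016, Lemma 3.2] -/
theorem enorm_apply_compSubConstCLM_le_of_eqOn_ball {T : 𝓢'(E, F)} {f : E → F}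
    (hT : ∀ θ : 𝓢(E, ℂ), T θ = ∫ y, θ y • f y) (Φ : 𝓢(E, ℂ)) {a : E} {r : ℝ} (hr : 0 < r)
    (hfa : ∀ y ∈ Metric.ball a r, f y = 0) (m : ℕ) :
    ‖T (SchwartzMap.compSubConstCLM ℂ a Φ)‖ₑ ≤
      ENNReal.ofReal (SchwartzMap.seminorm ℂ m 0 Φ) *
        ∫⁻ y in (Metric.ball a r)ᶜ, ENNReal.ofReal ((‖y - a‖ ^ m)⁻¹) * ‖f y‖ₑ := by
  rw [hT]
  refine (enorm_integral_le_lintegral_enorm _).trans ?_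
  set S : ℝ := SchwartzMap.seminorm ℂ m 0 Φ with hS
  have hS0 : 0 ≤ S := apply_nonneg _ _
  -- pointwise bound of the integrand by an indicator of the complement of the ball
  have hpt : ∀ y, ‖(SchwartzMap.compSubConstCLM ℂ a Φ) y • f y‖ₑ ≤
      (Metric.ball a r)ᶜ.indicator
        (fun y => ENNReal.ofReal S * (ENNReal.ofReal ((‖y - a‖ ^ m)⁻¹) * ‖f y‖ₑ)) y := by
    intro y
    by_cases hy : y ∈ Metric.ball a r
    · rw [hfa y hy, smul_zero, enorm_zero]
      exact bot_le
    · rw [Set.indicator_of_mem (Set.mem_compl hy), SchwartzMap.compSubConstCLM_apply, enorm_smul,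
        ← mul_assoc]
      gcongr
      have hya : y - a ≠ 0 := by
        intro h
        rw [sub_eq_zero] at h
        exact hy (h ▸ Metric.mem_ball_self hr)
      rw [← ofReal_norm, ← ENNReal.ofReal_mul hS0]
      exact ENNReal.ofReal_le_ofReal (norm_apply_le_seminorm_mul_inv_pow Φ m hya)
  calc ∫⁻ y, ‖(SchwartzMap.compSubConstCLM ℂ a Φ) y • f y‖ₑ
      ≤ ∫⁻ y, (Metric.ball a r)ᶜ.indicator
          (fun y => ENNReal.ofReal S * (ENNReal.ofReal ((‖y - a‖ ^ m)⁻¹) * ‖f y‖ₑ)) y :=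
        lintegral_mono hpt
    _ = ∫⁻ y in (Metric.ball a r)ᶜ,
          ENNReal.ofReal S * (ENNReal.ofReal ((‖y - a‖ ^ m)⁻¹) * ‖f y‖ₑ) :=
        lintegral_indicator Metric.isOpen_ball.measurableSet.compl _
    _ = ENNReal.ofReal S *
          ∫⁻ y in (Metric.ball a r)ᶜ, ENNReal.ofReal ((‖y - a‖ ^ m)⁻¹) * ‖f y‖ₑ :=
        lintegral_const_mul' _ _ ENNReal.ofReal_ne_top

/-- The values of `Ṡ_N T`: for a Schwartz representative `Ψ` of the symbol `χ(2^{-N}·)`,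
`⟨Ṡ_N T, θ⟩ = ∫ θ(a) ⟨T, (𝓕Ψ)(· - a)⟩ da` (`fourierMultiplierCLM_schwartz_apply_eq_integral`).
[cite: BahouriCheminDanchin2011, §2.1] -/
theorem lowFreqCutoff_apply_eq_integral_of_coe_eq [CompleteSpace F] {N : ℤ} {Ψ : 𝓢(E, ℂ)}
    (hΨ : (Ψ : E → ℂ) = lowFreqSymbol N) (T : 𝓢'(E, F)) (θ : 𝓢(E, ℂ)) :
    lowFreqCutoff N T θ = ∫ a, θ a • T (SchwartzMap.compSubConstCLM ℂ a (𝓕 Ψ)) := by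
  rw [lowFreqCutoff_apply, ← hΨ, fourierMultiplierCLM_schwartz_apply_eq_integral]

/-! ## Scaling of the kernels of `Ṡ_N` -/

omit [FiniteDimensional ℝ E] [MeasurableSpace E] [BorelSpace E] in
/-- A Schwartz representative of `χ(2^{-N}·)` is the dilate by `2^{-N}` of one of `χ`:
`Ψ_N = T_{2^{-N}} Ψ₀`. [folklore] -/
theorem eq_compSmulLeft_of_coe_eq_lowFreqSymbol {N : ℤ} {Ψ Ψ₀ : 𝓢(E, ℂ)}
    (hΨ : (Ψ : E → ℂ) = lowFreqSymbol N) (hΨ₀ : (Ψ₀ : E → ℂ) = lowFreqSymbol 0) :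
    Ψ = SchwartzMap.compCLMOfContinuousLinearEquiv ℂ
      (ContinuousLinearEquiv.smulLeft (Units.mk0 ((2 : ℝ) ^ (-N)) (zpow_ne_zero _ two_ne_zero)) :
        E ≃L[ℝ] E) Ψ₀ := by
  ext ξ
  rw [compSmulLeft_apply, Units.val_mk0, show Ψ ξ = lowFreqSymbol N ξ from congrFun hΨ ξ,
    show Ψ₀ (((2 : ℝ) ^ (-N)) • ξ) = lowFreqSymbol 0 (((2 : ℝ) ^ (-N)) • ξ) from congrFun hΨ₀ _,
    lowFreqSymbol_two_zpow_smul]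
  simp

/-- **The kernels of `Ṡ_N` are dilates of one kernel:** `(𝓕Ψ_N)(z) = 2^{Nd} (𝓕Ψ₀)(2^N z)`,
`d = dim E` (BCD §2.1: the kernel of `Ṡ_j` is `2^{jd} h(2^j ·)`).
[cite: BahouriCheminDanchin2011, §2.1] -/
theorem fourier_apply_of_coe_eq_lowFreqSymbol {N : ℤ} {Ψ Ψ₀ : 𝓢(E, ℂ)}
    (hΨ : (Ψ : E → ℂ) = lowFreqSymbol N) (hΨ₀ : (Ψ₀ : E → ℂ) = lowFreqSymbol 0) (z : E) :
    (𝓕 Ψ) z = ((((2 : ℝ) ^ N) ^ Module.finrank ℝ E : ℝ) : ℂ) * (𝓕 Ψ₀) (((2 : ℝ) ^ N) • z) := by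
  rw [eq_compSmulLeft_of_coe_eq_lowFreqSymbol hΨ hΨ₀, fourier_compSmulLeft, smul_apply,
    compSmulLeft_apply, smul_eq_mul]
  congr 2
  · rw [Units.val_mk0, ← zpow_natCast, ← zpow_mul, ← zpow_neg, abs_of_pos (zpow_pos two_pos _),
      ← zpow_natCast, ← zpow_mul]
    congr 1
    ring
  · rw [Units.val_inv_eq_inv_val, Units.val_mk0, zpow_neg, inv_inv]

omit [MeasurableSpace E] [BorelSpace E] in
/-- **Scaling of the Schwartz seminorms of the kernels of `Ṡ_N`:**
`p_{m,0}(𝓕Ψ_N) ≤ 2^{N(d-m)} p_{m,0}(𝓕Ψ₀)`. [cite: BahouriCheminDanchin2011, §2.1] -/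
theorem seminorm_fourier_le_of_coe_eq_lowFreqSymbol [MeasurableSpace E] [BorelSpace E] {N : ℤ}
    {Ψ Ψ₀ : 𝓢(E, ℂ)} (hΨ : (Ψ : E → ℂ) = lowFreqSymbol N) (hΨ₀ : (Ψ₀ : E → ℂ) = lowFreqSymbol 0)
    (m : ℕ) :
    SchwartzMap.seminorm ℂ m 0 (𝓕 Ψ) ≤
      (2 : ℝ) ^ ((N : ℝ) * ((Module.finrank ℝ E : ℝ) - m)) *
        SchwartzMap.seminorm ℂ m 0 (𝓕 Ψ₀) := by
  set d : ℕ := Module.finrank ℝ E with hd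
  have h2N : (0 : ℝ) < (2 : ℝ) ^ N := zpow_pos two_pos _
  refine SchwartzMap.seminorm_le_bound ℂ m 0 (𝓕 Ψ) (by positivity) fun z => ?_
  rw [norm_iteratedFDeriv_zero, fourier_apply_of_coe_eq_lowFreqSymbol hΨ hΨ₀ z, norm_mul,
    Complex.norm_real, Real.norm_of_nonneg (by positivity)]
  -- `‖z‖^m 2^{Nd} ‖𝓕Ψ₀(2^N z)‖ = 2^{N(d-m)} ‖2^N z‖^m ‖𝓕Ψ₀(2^N z)‖`
  have hkey := SchwartzMap.le_seminorm ℂ m 0 (𝓕 Ψ₀) (((2 : ℝ) ^ N) • z)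
  rw [norm_iteratedFDeriv_zero, norm_smul, Real.norm_of_nonneg h2N.le, mul_pow] at hkey
  have hsplit : (2 : ℝ) ^ ((N : ℝ) * ((d : ℝ) - m)) =
      ((2 : ℝ) ^ N) ^ d * (((2 : ℝ) ^ N) ^ m)⁻¹ := by
    rw [← Real.rpow_intCast 2 N, ← Real.rpow_natCast, ← Real.rpow_natCast,
      ← Real.rpow_mul two_pos.le, ← Real.rpow_mul two_pos.le, ← Real.rpow_neg two_pos.le,
      ← Real.rpow_add two_pos]
    congr 1
    ring
  rw [hsplit]
  have hm0 : (0 : ℝ) < ((2 : ℝ) ^ N) ^ m := pow_pos h2N m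
  calc ‖z‖ ^ m * (((2 : ℝ) ^ N) ^ d * ‖(𝓕 Ψ₀) (((2 : ℝ) ^ N) • z)‖)
      = ((2 : ℝ) ^ N) ^ d * (((2 : ℝ) ^ N) ^ m)⁻¹ *
          ((((2 : ℝ) ^ N) ^ m * ‖z‖ ^ m) * ‖(𝓕 Ψ₀) (((2 : ℝ) ^ N) • z)‖) := by
        field_simp
    _ ≤ ((2 : ℝ) ^ N) ^ d * (((2 : ℝ) ^ N) ^ m)⁻¹ * SchwartzMap.seminorm ℂ m 0 (𝓕 Ψ₀) := by
        gcongr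

/-! ## Off-diagonal decay of `Ṡ_N` -/

/-- **Off-diagonal decay of the low-frequency cut-offs.** Let `T` be given by integration against
`f`, vanishing on `B(a, r)` (`r > 0`), and let `Ψ_N`, `Ψ₀` be Schwartz representatives of the
symbols `χ(2^{-N}·)`, `χ`. Then for every `m ∈ ℕ` the value of `Ṡ_N T` at `a` obeys
`‖⟨T, (𝓕Ψ_N)(· - a)⟩‖ ≤ 2^{N(d-m)} p_{m,0}(𝓕Ψ₀) ∫_{|y-a| ≥ r} |y-a|^{-m} ‖f y‖ dy` (in `[0, ∞]`):
for `m > d` the values of `Ṡ_N T` where `f` vanishes to distance `r` tend to zero geometrically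
as `N → +∞` (Wang–Zhang 2017, proof of Lemma 3.2 localised; BCD §2.1).
[cite: WangZhang2016, Lemma 3.2] -/
theorem enorm_lowFreqCutoff_value_le_of_eqOn_ball {T : 𝓢'(E, F)} {f : E → F}
    (hT : ∀ θ : 𝓢(E, ℂ), T θ = ∫ y, θ y • f y) {N : ℤ} {Ψ Ψ₀ : 𝓢(E, ℂ)}
    (hΨ : (Ψ : E → ℂ) = lowFreqSymbol N) (hΨ₀ : (Ψ₀ : E → ℂ) = lowFreqSymbol 0) {a : E} {r : ℝ}
    (hr : 0 < r) (hfa : ∀ y ∈ Metric.ball a r, f y = 0) (m : ℕ) :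
    ‖T (SchwartzMap.compSubConstCLM ℂ a (𝓕 Ψ))‖ₑ ≤
      ENNReal.ofReal ((2 : ℝ) ^ ((N : ℝ) * ((Module.finrank ℝ E : ℝ) - m)) *
          SchwartzMap.seminorm ℂ m 0 (𝓕 Ψ₀)) *
        ∫⁻ y in (Metric.ball a r)ᶜ, ENNReal.ofReal ((‖y - a‖ ^ m)⁻¹) * ‖f y‖ₑ := by
  refine (enorm_apply_compSubConstCLM_le_of_eqOn_ball hT (𝓕 Ψ) hr hfa m).trans ?_
  gcongr
  exact seminorm_fourier_le_of_coe_eq_lowFreqSymbol hΨ hΨ₀ m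

end Literature.Analysis.FunctionSpaces

end
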